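import Summits.CriticalPhenomena.PercolationContinuityZ3.Theorems.Transplant.LinearGrowthCriticalProbOne
import HarnessLib

/-!
# Volume growth pulls back along rough embeddings: a bounded-degree graph that maps with bounded fibres and bounded edge-stretch into a graph of
# (lower) LINEAR growth has `p_c = 1` — no symmetry on either side (kernel)

builds on p205010 (kernel theorem, internal audit signed; external expert review pending) — nothing in this file uses p205010; unconditional, no node.
Lane `prim-bschramm`, seat `prim-bschramm-p4` gen 24 (PART C3 of `P4-GENERAL.md` §46).  Helper file (`--supports stmt-CriticalPhenomena-4575 --as helper`).

THE POINT.  Gen 24's `LinGrowth.criticalProb_eq_one_all` (lower linear growth at one vertex + degree bound ⟹ `p_c = 1`) and the path-map transfer of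
`p_c < 1` (`PathMapDom`, `GraphPathMap`) are the two directions of ONE rough-geometric picture.  This file supplies the growth half of the picture:
* **`GrowthMap.ballVolume_le`** — if `f : U → W` sends adjacent vertices of `H` to vertices joined by a walk of length `≤ L` in `G` and has point
  fibres of size `≤ K`, then `|B_H(x, n)| ≤ K · |B_G(f x, L n)|`;
* **`GrowthMap.linear_of_linear`** — hence lower linear growth of `G` at `f x` gives lower linear growth of `H` at `x` (constant `K C (L+1)`);
* **`GrowthMap.criticalProb_eq_one`** — so a connected graph `H` with degrees `≤ D` admitting such a map into a graph of lower linear growth has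
  `p_c(H) = 1` at every vertex (e.g. every bounded-degree graph roughly embedded in `ℤ`: ladders, tubes `ℤ × F`, decorated lines — p5's
  `SharpnessCriticalProbOne` instances — with no cutset bookkeeping).
[cite: LyonsPeres2016, §7.4 (linear growth; rough isometries, remark after Thm. 7.15)] [cite: BenjaminiSchramm1996, Conj. 4 ("assuming p_c < 1")]
-/

noncomputable section

namespace Summit.CriticalPhenomena.PercolationContinuityZ3.Theorems.Transplant

open SimpleGraph Filter Literature.Barriers.CriticalPhenomena Literature.Probability.LatticeModels Literature.Probability.Percolation
open scoped Classical

namespace GrowthMap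

variable {U W : Type} {H : SimpleGraph U} {G : SimpleGraph W}

/-- **Walks stretch by at most `L`**: a walk of length `k` in `H` maps to a walk of length `≤ L k` in `G` between the images. [folklore] -/
theorem exists_walk_map (f : U → W) {L : ℕ} (hL : ∀ x y, H.Adj x y → ∃ wk : G.Walk (f x) (f y), wk.length ≤ L) :
    ∀ {x y : U} (p : H.Walk x y), ∃ q : G.Walk (f x) (f y), q.length ≤ L * p.length
  | _, _, Walk.nil => ⟨Walk.nil, by simp⟩
  | _, _, Walk.cons h p => by
    obtain ⟨q, hq⟩ := exists_walk_map f hL p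
    obtain ⟨w, hw⟩ := hL _ _ h
    exact ⟨w.append q, by rw [Walk.length_append, Walk.length_cons]; nlinarith⟩

/-- **Balls map into balls**: `f(B_H(x, n)) ⊆ B_G(f x, L n)`. [folklore] -/
theorem graphBall_subset_preimage (f : U → W) {L : ℕ} (hL : ∀ x y, H.Adj x y → ∃ wk : G.Walk (f x) (f y), wk.length ≤ L) (x : U) (n : ℕ) :
    graphBall H x n ⊆ f ⁻¹' graphBall G (f x) (L * n) := by
  rintro y ⟨p, hp⟩
  obtain ⟨q, hq⟩ := exists_walk_map f hL p
  exact ⟨q, hq.trans (Nat.mul_le_mul_left L hp)⟩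

/-- **`|B_H(x, n)| ≤ K · |B_G(f x, L n)|`** for a map with edge-stretch `≤ L` and point fibres of size `≤ K` (target locally finite).
[cite: LyonsPeres2016, §7.4 (rough isometries)] -/
theorem ballVolume_le [G.LocallyFinite] (f : U → W) {L K : ℕ} (hL : ∀ x y, H.Adj x y → ∃ wk : G.Walk (f x) (f y), wk.length ≤ L)
    (hK : ∀ w, (f ⁻¹' {w}).Finite ∧ (f ⁻¹' {w}).ncard ≤ K) (x : U) (n : ℕ) :
    ballVolume H x n ≤ K * ballVolume G (f x) (L * n) := by
  have hfin : (graphBall G (f x) (L * n)).Finite := graphBall_finite G (f x) (L * n)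
  have hpre : f ⁻¹' graphBall G (f x) (L * n) = ⋃ w ∈ hfin.toFinset, f ⁻¹' {w} := by
    ext y; simp [Set.Finite.mem_toFinset]
  have hpre_fin : (f ⁻¹' graphBall G (f x) (L * n)).Finite := hfin.preimage' fun w _ => (hK w).1
  calc ballVolume H x n = (graphBall H x n).ncard := rfl
    _ ≤ (f ⁻¹' graphBall G (f x) (L * n)).ncard := Set.ncard_le_ncard (graphBall_subset_preimage f hL x n) hpre_fin
    _ = (⋃ w ∈ hfin.toFinset, f ⁻¹' {w}).ncard := by rw [hpre]
    _ ≤ ∑ w ∈ hfin.toFinset, (f ⁻¹' {w}).ncard := ncard_biUnion_le _ _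
    _ ≤ ∑ _w ∈ hfin.toFinset, K := Finset.sum_le_sum fun w _ => (hK w).2
    _ = K * ballVolume G (f x) (L * n) := by
        rw [Finset.sum_const, smul_eq_mul, mul_comm, ballVolume, Set.ncard_eq_toFinset_card _ hfin]

/-- **Lower linear growth pulls back**: if `|B_G(f x, N)| ≤ C(N+1)` for infinitely many `N`, then `|B_H(x, n)| ≤ K C (L+1) (n+1)` for infinitely
many `n`. [cite: LyonsPeres2016, §7.4 (linear growth; rough isometries)] -/
theorem linear_of_linear [G.LocallyFinite] (f : U → W) {L K : ℕ} (hL : ∀ x y, H.Adj x y → ∃ wk : G.Walk (f x) (f y), wk.length ≤ L)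
    (hK : ∀ w, (f ⁻¹' {w}).Finite ∧ (f ⁻¹' {w}).ncard ≤ K) (x : U) {C : ℕ}
    (hlin : ∀ N₀ : ℕ, ∃ N, N₀ ≤ N ∧ ballVolume G (f x) N ≤ C * (N + 1)) :
    ∀ N₀ : ℕ, ∃ n, N₀ ≤ n ∧ ballVolume H x n ≤ K * C * (L + 1) * (n + 1) := by
  intro N₀
  obtain ⟨N, hN, hvol⟩ := hlin ((L + 1) * (N₀ + 1))
  -- `n := N / (L+1)` has `L n ≤ N` and `n ≥ N₀`
  set n : ℕ := N / (L + 1) with hn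
  have hL1 : 0 < L + 1 := Nat.succ_pos L
  have hnN : L * n ≤ N := by
    calc L * n ≤ (L + 1) * n := Nat.mul_le_mul_right n (Nat.le_succ L)
      _ ≤ N := by rw [hn]; exact Nat.mul_div_le N (L + 1)
  have hn0 : N₀ ≤ n := by
    rw [hn, Nat.le_div_iff_mul_le hL1]
    calc N₀ * (L + 1) ≤ (N₀ + 1) * (L + 1) := Nat.mul_le_mul_right _ (Nat.le_succ _)
      _ = (L + 1) * (N₀ + 1) := by ring
      _ ≤ N := hN
  have hNn : N + 1 ≤ (L + 1) * (n + 1) := by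
    have := Nat.lt_div_mul_add hL1 (a := N)
    rw [← hn] at this
    nlinarith
  refine ⟨n, hn0, ?_⟩
  calc ballVolume H x n ≤ K * ballVolume G (f x) (L * n) := ballVolume_le f hL hK x n
    _ ≤ K * ballVolume G (f x) N := Nat.mul_le_mul_left K (Set.ncard_le_ncard (graphBall_mono G (f x) hnN) (graphBall_finite G (f x) N))
    _ ≤ K * (C * (N + 1)) := Nat.mul_le_mul_left K hvol
    _ ≤ K * (C * ((L + 1) * (n + 1))) := Nat.mul_le_mul_left K (Nat.mul_le_mul_left C hNn)
    _ = K * C * (L + 1) * (n + 1) := by ring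

/-- **THEOREM: a connected graph with degrees `≤ D` that maps with bounded edge-stretch and bounded fibres into a graph of lower LINEAR growth has
`p_c = 1` at every vertex** (and `θ(p_c) = 1` if infinite, by `LinGrowth.theta_criticalProb_eq_one`).  No symmetry on either graph.
[cite: LyonsPeres2016, §7.4 (linear growth; rough isometries)] [cite: BenjaminiSchramm1996, Conj. 4 ("assuming p_c < 1")] -/
theorem criticalProb_eq_one [H.LocallyFinite] [G.LocallyFinite] (hc : H.Connected) {D : ℕ} (hD : ∀ u, H.degree u ≤ D) (f : U → W) {L K : ℕ}
    (hL : ∀ x y, H.Adj x y → ∃ wk : G.Walk (f x) (f y), wk.length ≤ L) (hK : ∀ w, (f ⁻¹' {w}).Finite ∧ (f ⁻¹' {w}).ncard ≤ K) (x : U) {C : ℕ}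
    (hlin : ∀ N₀ : ℕ, ∃ N, N₀ ≤ N ∧ ballVolume G (f x) N ≤ C * (N + 1)) (y : U) : criticalProb H y = 1 :=
  LinGrowth.criticalProb_eq_one_all H x hc hD (linear_of_linear f hL hK x hlin) y

/-- … and `θ_y(p) = 0` for every `p < 1`. [cite: LyonsPeres2016, §7.4 (linear growth)] -/
theorem theta_eq_zero [H.LocallyFinite] [G.LocallyFinite] (hc : H.Connected) {D : ℕ} (hD : ∀ u, H.degree u ≤ D) (f : U → W) {L K : ℕ}
    (hL : ∀ x y, H.Adj x y → ∃ wk : G.Walk (f x) (f y), wk.length ≤ L) (hK : ∀ w, (f ⁻¹' {w}).Finite ∧ (f ⁻¹' {w}).ncard ≤ K) (x : U) {C : ℕ}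
    (hlin : ∀ N₀ : ℕ, ∃ N, N₀ ≤ N ∧ ballVolume G (f x) N ≤ C * (N + 1)) (y : U) (p : unitInterval) (hp : (p : ℝ) < 1) :
    theta H y p = 0 :=
  LinGrowth.theta_eq_zero_all H x hc hD (linear_of_linear f hL hK x hlin) y p hp

end GrowthMap

end Summit.CriticalPhenomena.PercolationContinuityZ3.Theorems.Transplant

end
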